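import Summits.ResolutionOfSingularities.ResolutionOfSingularities.Theorems.FrobeniusClosingPatchingRelPerfectDepthGradedStructureMaps
import Literature.AlgebraicGeometry.Motives.FormsEmbedding
import Literature.AlgebraicGeometry.Resolution.BlowupsScaling
import Literature.AlgebraicGeometry.Resolution.BlowupsComposition
import HarnessLib

/-!
# Crux `PatchingRelPerfect` (stmt-ResolutionOfSingularities-16161), chain w52 — R4 X-side, graded initial
# state (D): chart calculus on `X₁ = Bl_𝔪 Spec S` for the retraction `r₀ : X₁ → ℙᵐ_{κ₀}`

[OURS · L1 W5.2 · rung tool] res-L1-w52-plan-1 g6 RATIFY 2026-08-27 «res-D-pv-055 (D) initial retraction +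
graded format over a COEFFICIENT FIELD — GO»; companion of `…DepthGradedRetraction` /
`…DepthGradedStructureMaps`, consumed by `…DepthGradedFormatInitial`.  Setting: `y = (y₀, …, y_m)` in a
ring `S`, `𝔪 = (y)`, `κ₀` a field with `κ₀ → S`, `X₁ = Proj S[𝔪t]` (`affineBlowup`, `g = affineBlowup.π`),
`r₀ = Proj.map (T_j ↦ y_j t) ≫ Proj.map (κ₀ → S) : X₁ → ℙᵐ_{κ₀}`, chart `D₊(y_i t) = Spec (S[𝔪t]_{y_i t})₀`.
PROVED (fact-free):

* `comap_awayι_comap_π` — `J~𝒪_{X₁}` on the chart is `(J · (S[𝔪t]_{y_i t})₀)~`;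
* `reesAwayBase_eq_mul`, `map_reesAwayBase_span_eq` — `y_j/1 = (y_j t/y_i t)·(y_i/1)`, so
  `𝔪 · (S[𝔪t]_{y_i t})₀ = (y_i/1)`;
* `appLE_awayι_awayToSection` (any `Proj`) — pulling `awayToSection f c ∈ Γ(Proj A, D₊(f))` back along
  the chart `Spec (A_f)₀ → Proj A` gives `c` (Mathlib `basicOpenToSpec_app_top` read backwards);
* `awayι_comp_retraction₀` — the chart square of `r₀` (Mathlib `Proj.awayι_comp_map`, twice);
  `appLE_awayι_retraction₀` — pulling `awayToSection a`, `a ∈ (κ₀[T]_{T_i})₀`, back along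
  `D₊(y_i t) → X₁ → ℙᵐ_{κ₀}` gives `Away.map (T ↦ y t) (Away.map (κ₀ → S) a)`;
* `reesAwayBase_pow_mul_awayMap` — **`(y_i/1)ᵉ · (F(y)tᵉ/(y_i t)ᵉ) = F(y)/1`** for a form `F` of degree
  `e` over `κ₀`: the dehomogenisation identity `F(y) = y_iᵉ F(y/y_i)` in the chart ring.

The standard gradings `MvPolynomial.gradedAlgebra` are switched on locally (as in the Literature files
this builds on).  Nothing here is a statement of the manuscript under review.

## References

* R. Hartshorne, *Algebraic Geometry* (1977), II Thm. 7.1 (a), Prop. 7.2. [Hartshorne1977]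
* U. Görtz, T. Wedhorn, *Algebraic Geometry I*, 2nd ed. (2020), (13.9), Def. 13.90. [GortzWedhorn2020]
-/

-- `Summit.<Summit>.<Sub>.Theorems` with `Sub = Summit` (single-conjunct summit, D-0017)

set_option linter.dupNamespace false

noncomputable section

open CategoryTheory CategoryTheory.Limits AlgebraicGeometry Literature.AlgebraicGeometry.Resolution
open IsLocalRing TopologicalSpace HomogeneousLocalization
open Literature.AlgebraicGeometry.Motives Literature.AlgebraicGeometry.Motives.ProjBaseChangeRing

-- The standard gradings of polynomial rings are `def`s in Mathlib; as in the Literature files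
-- `Resolution/ExceptionalDivisorProjCharts`, `Motives/ProjBaseChangeAny` they are switched on locally.
attribute [local instance] MvPolynomial.gradedAlgebra

namespace Summit.ResolutionOfSingularities.ResolutionOfSingularities.Theorems

namespace DepthOne

universe u

section Chart

variable {S : Type u} [CommRing S] {m : ℕ} (y : Fin (m + 1) → S)
  (κ₀ : Type u) [Field κ₀] [Algebra κ₀ S]

local notation3 "M" => Ideal.span (Set.range y)
local notation3 "ℛ" => reesGrading (Ideal.span (Set.range y))
local notation3 "X₁" => affineBlowup (Ideal.span (Set.range y))
local notation3 "g" => affineBlowup.π (Ideal.span (Set.range y))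
local notation3 "𝒜κ" => MvPolynomial.homogeneousSubmodule (Fin (m + 1)) κ₀
/-- the chart element `y_i t ∈ S[𝔪t]`, spelled as the image of `T_i` under the graded presentation
composed with the base change (so that Mathlib's `Proj.map` chart lemmas apply verbatim) -/
local notation3 "sElt" => fun (i : Fin (m + 1)) =>
  (reesPresentation y) ((mapGraded κ₀ S (Fin (m + 1))) (MvPolynomial.X i))

/-- `y_i t` (in its `Proj.map` spelling) has degree one. [folklore] -/
theorem sElt_mem (i : Fin (m + 1)) : sElt i ∈ ℛ 1 :=
  (reesPresentation y).2 ((mapGraded κ₀ S (Fin (m + 1))).2 (ProjectiveSpace.X_mem i))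

omit [Algebra κ₀ S] [Field κ₀] in
/-- Pulling `J~𝒪_{X₁}` back to the chart `D₊(s) = Spec (S[𝔪t]_s)₀` gives `(J · (S[𝔪t]_s)₀)~`. [folklore] -/
theorem comap_awayι_comap_π (J : Ideal S) (s : reesAlgebra (M)) {d : ℕ} (hs : s ∈ ℛ d) (hd : 0 < d) :
    ((affineBlowup.idealSheaf J).comap g).comap (Proj.awayι ℛ s hs hd) =
      affineBlowup.idealSheaf (J.map (reesAwayBase y s)) := by
  rw [← Scheme.IdealSheafData.comap_comp, awayι_comp_π y s hs hd, comap_idealSheaf_specMap]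

/-! ### The identities in the chart ring `(S[𝔪t]_{y_i t})₀` -/

omit [Algebra κ₀ S] [Field κ₀] in
/-- In `(S[𝔪t]_{s})₀`, `s = y_i t`: `y_j/1 = (y_j t / y_i t) · (y_i/1)`. [folklore] -/
theorem reesAwayBase_eq_mul (s : reesAlgebra (M)) (hs : s ∈ ℛ 1) (i j : Fin (m + 1))
    (hsi : (s : Polynomial S) = Polynomial.monomial 1 (y i)) :
    reesAwayBase y s (y j) =
      HomogeneousLocalization.Away.mk ℛ hs 1 (reesT (y j) (Ideal.mem_span_range_self (f := y) (x := j)))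
        (by simpa using reesT_mem (y j) (Ideal.mem_span_range_self (f := y) (x := j))) *
      reesAwayBase y s (y i) := by
  apply val_injective
  rw [val_mul, val_reesAwayBase, val_reesAwayBase, Away.val_mk, Localization.mk_mul,
    Localization.mk_eq_mk_iff, Localization.r_iff_exists]
  refine ⟨1, ?_⟩
  simp only [OneMemClass.coe_one, one_mul, Submonoid.coe_mul]
  apply Subtype.ext
  simp only [Subalgebra.coe_mul, pow_one, hsi, coe_reesT, Subalgebra.coe_algebraMap,
    Polynomial.algebraMap_apply, Algebra.algebraMap_self, RingHom.id_apply, OneMemClass.coe_one, one_mul,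
    Polynomial.C_mul_monomial, mul_comm]

omit [Algebra κ₀ S] [Field κ₀] in
/-- `𝔪 · (S[𝔪t]_{y_i t})₀ = (y_i/1)`. [folklore] -/
theorem map_reesAwayBase_span_eq (s : reesAlgebra (M)) (hs : s ∈ ℛ 1) (i : Fin (m + 1))
    (hsi : (s : Polynomial S) = Polynomial.monomial 1 (y i)) :
    (M).map (reesAwayBase y s) = Ideal.span {reesAwayBase y s (y i)} := by
  apply le_antisymm
  · rw [Ideal.map_span, Ideal.span_le]
    rintro _ ⟨_, ⟨j, rfl⟩, rfl⟩
    rw [SetLike.mem_coe, reesAwayBase_eq_mul y s hs i j hsi]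
    exact Ideal.mul_mem_left _ _ (Ideal.mem_span_singleton_self _)
  · rw [Ideal.span_le, Set.singleton_subset_iff]
    exact Ideal.mem_map_of_mem _ (Ideal.subset_span ⟨i, rfl⟩)

/-! ### Sections over the chart `Spec (A_f)₀ → Proj A` -/

omit [Algebra κ₀ S] [Field κ₀] in
/-- **Pulling a section `awayToSection f c ∈ Γ(Proj A, D₊(f))` back along the chart
`awayι : Spec (A_f)₀ → Proj A` gives `c`** (through `Γ(Spec (A_f)₀, ⊤) ≅ (A_f)₀`): Mathlib's
`basicOpenToSpec_app_top` read backwards. [folklore] -/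
theorem appLE_awayι_awayToSection {A σ : Type u} [CommRing A] [SetLike σ A] [AddSubgroupClass σ A]
    (𝒜 : ℕ → σ) [GradedRing 𝒜] (f : A) {d : ℕ} (hf : f ∈ 𝒜 d) (hd : 0 < d)
    (h : (⊤ : (Spec (.of (Away 𝒜 f))).Opens) ≤ Proj.awayι 𝒜 f hf hd ⁻¹ᵁ Proj.basicOpen 𝒜 f)
    (c : Away 𝒜 f) :
    (Proj.awayι 𝒜 f hf hd).appLE (Proj.basicOpen 𝒜 f) ⊤ h (Proj.awayToSection 𝒜 f c) =
      (Scheme.ΓSpecIso (.of (Away 𝒜 f))).inv c := by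
  -- `awayι = e.inv ≫ D₊(f).ι` with `e = basicOpenIsoSpec`
  have h1 : (Proj.awayι 𝒜 f hf hd).appLE (Proj.basicOpen 𝒜 f) ⊤ h =
      (Proj.basicOpen 𝒜 f).ι.appLE (Proj.basicOpen 𝒜 f) ⊤ (fun x _ => x.2) ≫
        (Proj.basicOpenIsoSpec 𝒜 f hf hd).inv.appLE ⊤ ⊤ le_top := by
    rw [Scheme.Hom.appLE_comp_appLE]
    rfl
  -- `D₊(f).ι^* : Γ(Proj, D₊ f) → Γ(D₊ f, ⊤)` is `topIso.inv`
  have h2 : (Proj.basicOpen 𝒜 f).ι.appLE (Proj.basicOpen 𝒜 f) ⊤ (fun x _ => x.2) =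
      (Proj.basicOpen 𝒜 f).topIso.inv := by
    rw [Scheme.Opens.ι_appLE, Scheme.Opens.topIso_inv]
    congr 1
  have h3 : (Proj.basicOpenIsoSpec 𝒜 f hf hd).inv.appLE ⊤ ⊤ le_top =
      (Proj.basicOpenIsoSpec 𝒜 f hf hd).inv.app ⊤ :=
    (Scheme.Hom.app_eq_appLE _).symm
  -- `e.hom^* = ΓSpecIso.hom ≫ awayToSection ≫ topIso.inv` (Mathlib), so `topIso.inv ≫ e.inv^*` undoes it
  have H : (Proj.basicOpenIsoSpec 𝒜 f hf hd).hom.app ⊤ = (Scheme.ΓSpecIso (.of (Away 𝒜 f))).hom ≫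
      Proj.awayToSection 𝒜 f ≫ (Proj.basicOpen 𝒜 f).topIso.inv := by
    rw [Proj.basicOpenIsoSpec_hom]
    exact Proj.basicOpenToSpec_app_top 𝒜 f
  have H' : Proj.awayToSection 𝒜 f ≫ (Proj.basicOpen 𝒜 f).topIso.inv =
      (Scheme.ΓSpecIso (.of (Away 𝒜 f))).inv ≫ (Proj.basicOpenIsoSpec 𝒜 f hf hd).hom.app ⊤ :=
    ((congrArg ((Scheme.ΓSpecIso (.of (Away 𝒜 f))).inv ≫ ·) H).trans
      ((Scheme.ΓSpecIso (.of (Away 𝒜 f))).inv_hom_id_assoc _)).symm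
  have H'' : (Proj.basicOpenIsoSpec 𝒜 f hf hd).hom.app ⊤ ≫ (Proj.basicOpenIsoSpec 𝒜 f hf hd).inv.app ⊤ =
      𝟙 _ :=
    (Scheme.Hom.comp_appTop _ _).symm.trans
      ((congrArg Scheme.Hom.appTop (Proj.basicOpenIsoSpec 𝒜 f hf hd).inv_hom_id).trans Scheme.Hom.id_appTop)
  have h4 : Proj.awayToSection 𝒜 f ≫ (Proj.basicOpen 𝒜 f).topIso.inv ≫
      (Proj.basicOpenIsoSpec 𝒜 f hf hd).inv.app ⊤ = (Scheme.ΓSpecIso (.of (Away 𝒜 f))).inv :=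
    (Category.assoc _ _ _).symm.trans <| (eq_whisker H' _).trans <| (Category.assoc _ _ _).trans <|
      (congrArg ((Scheme.ΓSpecIso (.of (Away 𝒜 f))).inv ≫ ·) H'').trans (Category.comp_id _)
  rw [h1, h2, h3]
  exact congrArg (fun φ => φ.hom c) h4

/-! ### The chart of `r₀` -/

/-- `r₀` written out (as in `…DepthGradedRetraction`). -/
local notation3 "R₀" => (Proj.map (reesPresentation y) (irrelevant_le_map_reesPresentation y) ≫
  Proj.map (mapGraded κ₀ S (Fin (m + 1))) (irrelevant_le_map κ₀ S (Fin (m + 1))) :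
    affineBlowup (Ideal.span (Set.range y)) ⟶ ProjSpace.P m κ₀)

/-- `T_i ∈ S[T]` (base-changed) has degree one. [folklore] -/
theorem mapGraded_X_mem (i : Fin (m + 1)) :
    (mapGraded κ₀ S (Fin (m + 1))) (MvPolynomial.X i) ∈ MvPolynomial.homogeneousSubmodule (Fin (m + 1)) S 1 :=
  (mapGraded κ₀ S (Fin (m + 1))).2 (ProjectiveSpace.X_mem i)

/-- **The chart square of `r₀`**: `D₊(y_i t) = Spec (S[𝔪t]_{y_i t})₀ → X₁ → ℙᵐ_{κ₀}` is
`Spec` of the two `Away.map`s followed by the chart `D₊(T_i) ↪ ℙᵐ_{κ₀}` (Mathlib `Proj.awayι_comp_map`,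
twice). [folklore] -/
theorem awayι_comp_retraction₀ (i : Fin (m + 1)) :
    Proj.awayι ℛ (sElt i) (sElt_mem y κ₀ i) one_pos ≫ R₀ =
      Spec.map (CommRingCat.ofHom (Away.map (reesPresentation y)
          ((mapGraded κ₀ S (Fin (m + 1))) (MvPolynomial.X i)))) ≫
        Spec.map (CommRingCat.ofHom (Away.map (mapGraded κ₀ S (Fin (m + 1))) (MvPolynomial.X i))) ≫
          Proj.awayι 𝒜κ (MvPolynomial.X i) (ProjectiveSpace.X_mem i) one_pos := by
  have e1 := Proj.awayι_comp_map (reesPresentation y) (irrelevant_le_map_reesPresentation y) one_pos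
    ((mapGraded κ₀ S (Fin (m + 1))) (MvPolynomial.X i)) (mapGraded_X_mem κ₀ i)
  have e2 := Proj.awayι_comp_map (mapGraded κ₀ S (Fin (m + 1))) (irrelevant_le_map κ₀ S (Fin (m + 1)))
    one_pos (MvPolynomial.X i) (ProjectiveSpace.X_mem (R := κ₀) i)
  exact (Category.assoc _ _ _).symm.trans <| (eq_whisker e1 _).trans <| (Category.assoc _ _ _).trans <|
    congrArg (Spec.map (CommRingCat.ofHom (Away.map (reesPresentation y)
      ((mapGraded κ₀ S (Fin (m + 1))) (MvPolynomial.X i)))) ≫ ·) e2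

omit [Algebra κ₀ S] [Field κ₀] in
/-- The source of a morphism maps into its open range. [folklore] -/
theorem top_le_preimage_of_opensRange_eq {X Y : Scheme.{u}} (f : X ⟶ Y) [IsOpenImmersion f]
    {U : Y.Opens} (hU : f.opensRange = U) : (⊤ : X.Opens) ≤ f ⁻¹ᵁ U := by
  intro x _
  show f x ∈ (U : Set Y)
  rw [← hU]
  exact ⟨x, rfl⟩

omit [Algebra κ₀ S] [Field κ₀] in
/-- Transport of `appLE` along an equality of morphisms (elementwise). [folklore] -/
theorem appLE_apply_congr {X Y : Scheme.{u}} {φ ψ : X ⟶ Y} (hφ : φ = ψ) (U : Y.Opens) (V : X.Opens)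
    (h : V ≤ φ ⁻¹ᵁ U) (x : Γ(Y, U)) : φ.appLE U V h x = ψ.appLE U V (hφ ▸ h) x := by
  subst hφ
  rfl

omit [Algebra κ₀ S] [Field κ₀] in
/-- `Spec(φ)^*` on global sections is `φ` (through `ΓSpecIso`). [folklore] -/
theorem appTop_specMap_ΓSpecIso_inv {A B : Type u} [CommRing A] [CommRing B] (φ : A →+* B) (a : A) :
    (Spec.map (CommRingCat.ofHom φ)).appTop ((Scheme.ΓSpecIso (.of A)).inv a) =
      (Scheme.ΓSpecIso (.of B)).inv (φ a) := by
  have h := Scheme.ΓSpecIso_inv_naturality (CommRingCat.ofHom φ)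
  exact (congrArg (fun ψ => ψ.hom a) h).symm

set_option maxHeartbeats 400000 in
/-- **The chart value of a pulled-back form**: pulling `awayToSection (a) ∈ Γ(ℙᵐ_{κ₀}, D₊(T_i))` back
along `D₊(y_i t) → X₁ → ℙᵐ_{κ₀}` gives `Away.map (T ↦ y t) (Away.map (κ₀ → S) a) ∈ (S[𝔪t]_{y_i t})₀`
(through `ΓSpecIso`). [folklore] -/
theorem appLE_awayι_retraction₀ (i : Fin (m + 1))
    (h : (⊤ : (Spec (.of (Away ℛ (sElt i)))).Opens) ≤
      (Proj.awayι ℛ (sElt i) (sElt_mem y κ₀ i) one_pos ≫ R₀) ⁻¹ᵁ Proj.basicOpen 𝒜κ (MvPolynomial.X i))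
    (a : Away 𝒜κ (MvPolynomial.X i)) :
    (Proj.awayι ℛ (sElt i) (sElt_mem y κ₀ i) one_pos ≫ R₀).appLE (Proj.basicOpen 𝒜κ (MvPolynomial.X i)) ⊤ h
        (Proj.awayToSection 𝒜κ (MvPolynomial.X i) a) =
      (Scheme.ΓSpecIso (.of (Away ℛ (sElt i)))).inv
        (Away.map (reesPresentation y) ((mapGraded κ₀ S (Fin (m + 1))) (MvPolynomial.X i))
          (Away.map (mapGraded κ₀ S (Fin (m + 1))) (MvPolynomial.X i) a)) := by
  rw [appLE_apply_congr (awayι_comp_retraction₀ y κ₀ i)]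
  -- split `(Spec A₁ ≫ Spec A₂ ≫ awayι).appLE` as `awayι.appLE ≫ (Spec A₁ ≫ Spec A₂).appTop`
  have hsplit := Scheme.Hom.appLE_comp_appLE
    (Spec.map (CommRingCat.ofHom (Away.map (reesPresentation y)
        ((mapGraded κ₀ S (Fin (m + 1))) (MvPolynomial.X i)))) ≫
      Spec.map (CommRingCat.ofHom (Away.map (mapGraded κ₀ S (Fin (m + 1))) (MvPolynomial.X i))))
    (Proj.awayι 𝒜κ (MvPolynomial.X i) (ProjectiveSpace.X_mem i) one_pos)
    (Proj.basicOpen 𝒜κ (MvPolynomial.X i)) ⊤ ⊤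
    (top_le_preimage_of_opensRange_eq _ (Proj.opensRange_awayι 𝒜κ (MvPolynomial.X i)
      (ProjectiveSpace.X_mem i) one_pos)) le_top
  have happ := congrArg (fun ψ => ψ.hom (Proj.awayToSection 𝒜κ (MvPolynomial.X i) a)) hsplit
  simp only [CommRingCat.hom_comp, RingHom.coe_comp, Function.comp_apply] at happ
  refine happ.symm.trans ?_
  rw [appLE_awayι_awayToSection 𝒜κ (MvPolynomial.X i) (ProjectiveSpace.X_mem i) one_pos]
  have hTop : (Spec.map (CommRingCat.ofHom (Away.map (reesPresentation y)
        ((mapGraded κ₀ S (Fin (m + 1))) (MvPolynomial.X i)))) ≫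
      Spec.map (CommRingCat.ofHom (Away.map (mapGraded κ₀ S (Fin (m + 1))) (MvPolynomial.X i)))).appLE
        ⊤ ⊤ le_top =
      (Spec.map (CommRingCat.ofHom (Away.map (reesPresentation y)
        ((mapGraded κ₀ S (Fin (m + 1))) (MvPolynomial.X i)))) ≫
      Spec.map (CommRingCat.ofHom (Away.map (mapGraded κ₀ S (Fin (m + 1))) (MvPolynomial.X i)))).appTop :=
    (Scheme.Hom.app_eq_appLE _).symm
  refine (congrArg (fun ψ => ψ.hom ((Scheme.ΓSpecIso (.of (Away 𝒜κ (MvPolynomial.X i)))).inv a))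
    hTop).trans ?_
  change (Spec.map (CommRingCat.ofHom (Away.map (reesPresentation y)
      ((mapGraded κ₀ S (Fin (m + 1))) (MvPolynomial.X i))))).appTop
    ((Spec.map (CommRingCat.ofHom (Away.map (mapGraded κ₀ S (Fin (m + 1))) (MvPolynomial.X i)))).appTop
      ((Scheme.ΓSpecIso (.of (Away 𝒜κ (MvPolynomial.X i)))).inv a)) = _
  rw [appTop_specMap_ΓSpecIso_inv, appTop_specMap_ΓSpecIso_inv]

/-! ### The form identity `y_iᵉ · F(y)/(y_i t)ᵉ = F(y)` in the chart ring -/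

/-- The chart element `y_i t` as a polynomial: `monomial 1 (y i)`. [folklore] -/
theorem coe_sElt (i : Fin (m + 1)) : ((sElt i : reesAlgebra (M)) : Polynomial S) = Polynomial.monomial 1 (y i) := by
  change ((reesPresentation y ((mapGraded κ₀ S (Fin (m + 1))) (MvPolynomial.X i)) : reesAlgebra (M)) :
    Polynomial S) = _
  rw [mapGraded_X, reesPresentation_X, coe_reesT]

/-- **`(y_i/1)ᵉ · (F(y)tᵉ/(y_i t)ᵉ) = F(y)/1`** in `(S[𝔪t]_{y_i t})₀` for a form `F` of degree `e` over
`κ₀` (its dehomogenisation `F/T_iᵉ ∈ (κ₀[T]_{T_i})₀` pushed along the two `Away.map`s): the chart form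
of `F(y) = y_iᵉ · F(y/y_i)`. [folklore] -/
theorem reesAwayBase_pow_mul_awayMap (i : Fin (m + 1)) {e : ℕ} (F : MvPolynomial (Fin (m + 1)) κ₀)
    (hF : F ∈ MvPolynomial.homogeneousSubmodule (Fin (m + 1)) κ₀ e) :
    reesAwayBase y (sElt i) (y i) ^ e *
        Away.map (reesPresentation y) ((mapGraded κ₀ S (Fin (m + 1))) (MvPolynomial.X i))
          (Away.map (mapGraded κ₀ S (Fin (m + 1))) (MvPolynomial.X i)
            (Away.isLocalizationElem (ProjectiveSpace.X_mem (R := κ₀) i) hF)) =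
      reesAwayBase y (sElt i) (MvPolynomial.aeval y F) := by
  have hFS : (MvPolynomial.map (algebraMap κ₀ S) F ^ 1).IsHomogeneous e := by
    rw [pow_one]
    exact (hF : F.IsHomogeneous e).map _
  have hcoe : ((reesPresentation y ((mapGraded κ₀ S (Fin (m + 1))) (F ^ 1)) : reesAlgebra (M)) :
      Polynomial S) = Polynomial.monomial e (MvPolynomial.aeval y F) := by
    rw [reesPresentation_apply, mapGraded_apply, map_pow, coe_reesPresentationₐ_of_isHomogeneous y hFS,
      pow_one, MvPolynomial.eval_map, ← MvPolynomial.aeval_def]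
  apply val_injective
  simp only [val_mul, val_pow, val_reesAwayBase, Away.isLocalizationElem, Away.map_mk, Away.val_mk,
    Localization.mk_pow, Localization.mk_mul, one_pow, one_mul]
  rw [Localization.mk_eq_mk_iff, Localization.r_iff_exists]
  refine ⟨1, ?_⟩
  simp only [OneMemClass.coe_one, one_mul]
  apply Subtype.ext
  simp only [Subalgebra.coe_mul, SubmonoidClass.coe_pow, hcoe, coe_sElt, Subalgebra.coe_algebraMap,
    Polynomial.algebraMap_apply, Algebra.algebraMap_self, RingHom.id_apply, mul_one,
    ← Polynomial.C_pow, Polynomial.C_mul_monomial, Polynomial.monomial_pow, Polynomial.monomial_mul_C,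
    mul_comm]

end Chart

end DepthOne

end Summit.ResolutionOfSingularities.ResolutionOfSingularities.Theorems

end
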